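import Literature.Probability.RandomPlanarGeometry.SAWTriangularBridgeRenewal
import Literature.Probability.RandomPlanarGeometry.SAWTriangularFiniteMemory
import HarnessLib

/-!
# A certified lower bound `μ(𝕋) > 3.91` for the connective constant of the triangular lattice,
# by Kesten's irreducible-bridge inequality `Σ_n λ_n(𝕋) μ(𝕋)^{-n} ≤ 1`
# and kernel-certified counts `λ_n(𝕋)`, `n ≤ 11`

Topic `Literature/Probability/RandomPlanarGeometry` (continues `SAWTriangularBridgeRenewal.lean`: the
irreducible bridges `brickIrreducibleBridges n` of `𝕋` in the brick frame, `λ_n(𝕋) = brickIrreducibleBridgeCount n`,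
and the certificate principle `inv_lt_exp_logMuTri_of_one_lt_sum`: any truncation of `Σ_k λ_k(𝕋) x^k`
exceeding `1` at `x > 0` certifies `μ(𝕋) > 1/x`; and `SAWTriangularWords.lean`: six-letter step words,
`triVerts`, `IsTriSAW`, `triSawWords n`, the bijection with `triSL n`). Sources: the method is that of the printed
lower bounds for connective constants from irreducible bridges — I. Jensen, *Improved lower bounds on the
connective constants for two-dimensional self-avoiding walks*, J. Phys. A 37 (2004) 11521–11529, §2 ("if
`0 ≤ ã_n ≤ a_n` … then with `x_c` being the solution to `Σ_n ã_n x^n = 1`, `1/x_c` is a lower bound on `μ`. In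
particular we can set `ã_n = 0` for `n > N` and thus truncate the series", `a_n` = the number of `n`-step
irreducible bridges; results: "For the triangular lattice the lower bound is, `4.118935 < μ_tri` … whereas the
previous best bound was `4.03333 < μ_tri`", from bridges of span `≤ 12` and length `≤ 150` counted by transfer
matrices; re-quoted in S. E. Alm, J. Phys. A 38 (2005) 2055–2080, §5.5.1), resting on H. Kesten, J. Math. Phys. 4
(1963) 960–969, §4
and N. Madras, G. Slade, *The Self-Avoiding Walk* (1993), §4.2, eq. (4.2.4) (p. 91) (`Σ_N λ_N z_c^N ≤ 1`, there
for `ℤ^d`; for `𝕋` it is the tree theorem `sum_brickIrreducibleBridgeCount_div_pow_le_one`).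

## What is here

* `TriIrrCert.dfs n` — an UNTRUSTED depth-first enumeration (integer-pair model, prefix-pruned on
  self-avoidance and on the half-space condition) of the step words of the `n`-step irreducible bridges of `𝕋`;
* `TriIrrCert.WordOK n w` — the VERIFIED acceptance test: `|w| = n`, `w` self-avoiding, and the list of brick
  heights `X_i = 2x_i + y_i` passes `irrB n` (a bridge on `[0,n]` with no renewal time), which implies
  (`isIrreducibleBridge_of_irrB`, via `segB_iff`) that the brick-frame vertex function `brickFun n (triVerts w)` is
  an irreducible bridge in the tree's sense (`Zd.IsIrreducibleBridge`); `TriIrrCert.cert n m` —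
  the emitted list has length `m`, every word passes `WordOK n`, and the list is strictly increasing in an integer
  encoding (hence duplicate-free); **`TriIrrCert.le_of_cert : cert n m = true → m ≤ λ_n(𝕋)`** (the accepted words
  inject into `brickIrreducibleBridges n` by `triVerts_mem_triSL`, `triVerts_injOn`, `brickFun_injOn`);
* the evaluations (one `native_decide` each; computational class): `λ_n(𝕋) ≥ 3, 0, 4, 12, 20, 90, 242, 856, 2890,
  10088, 35988` for `n = 1, …, 11` (these are the exact values; only `≥` is certified and only `≥` is used);
* **`exp_logMuTri_gt_391_div_100 : 391/100 < μ(𝕋)`**, i.e. `μ(𝕋) > 3.91`, from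
  `Σ_{n ≤ 11} λ_n (100/391)^n ≥ 1.0022 > 1` (exact rational arithmetic) and the certificate principle; and the
  logarithmic form `log_391_div_100_lt_logMuTri`.

Status of the numeral. Printed lower bounds for `μ(𝕋)` by this method go much further (Jensen 2004 §2:
`4.118935 < μ_tri`; previously Alm's `4.03333`); the series estimate is `μ(𝕋) = 4.150797226(26)` (ibid.). The
present bound is numerically WEAKER than both printed bounds (truncation at `n ≤ 11` against their high-order
series); what is new is only that it is kernel-checked, counts included: it lifts the tree's certified window for `μ(𝕋)` from
`[(3+√17)/2, 4.271] = [3.5616, 4.271]` (`log_lambda_le_logMuTri`, `exp_logMuTri_le_4271`) to `[3.91, 4.271]`. The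
height used here is the brick coordinate `X = 2x + y` (any height function with the bridge decomposition gives
Kesten's inequality; the counts `λ_n(𝕋)` depend on this choice, the bound on `μ(𝕋)` does not). Axioms: standard
plus the ten `native_decide` count certificates (`Lean.ofReduceBool`).
-/

open Finset Literature.Probability.LatticeModels Literature.Probability.Percolation SimpleGraph
open scoped BigOperators

namespace Literature.Probability.RandomPlanarGeometry.SAW

namespace TriIrrCert

/-! ### The untrusted search (integer-pair model) -/

/-- Brick height `X = 2x + y` of an axial pair. [cite: Jensen2004SAWLowerBounds, §2] -/
def hgt (p : ℤ × ℤ) : ℤ := 2 * p.1 + p.2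

/-- `hs[i] ≤ X` for the `f` indices `i, i+1, …, i+f-1` (allocation-free loop). Untrusted search helper.
[cite: Jensen2004SAWLowerBounds, §2] -/
def allLe (hs : Array ℤ) (X : ℤ) : ℕ → ℕ → Bool
  | _, 0 => true
  | i, f + 1 => hs.getD i 0 ≤ X && allLe hs X (i + 1) f

/-- `X < hs[j]` for the `f` indices `j, j+1, …, j+f-1` (allocation-free loop). Untrusted search helper.
[cite: Jensen2004SAWLowerBounds, §2] -/
def allGt (hs : Array ℤ) (X : ℤ) : ℕ → ℕ → Bool
  | _, 0 => true
  | j, f + 1 => X < hs.getD j 0 && allGt hs X (j + 1) f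

/-- Is one of the `f` times `s, s+1, …, s+f-1` a renewal time of the height array `hs` of length `n+1`
(`hs[i] ≤ hs[s]` for `1 ≤ i ≤ s` and `hs[s] < hs[j]` for `s < j ≤ n`)? Untrusted search helper.
[cite: Jensen2004SAWLowerBounds, §2] -/
def anyRenewal (hs : Array ℤ) (n : ℕ) : ℕ → ℕ → Bool
  | _, 0 => false
  | s, f + 1 => (allLe hs (hs.getD s 0) 1 s && allGt hs (hs.getD s 0) (s + 1) (n - s)) || anyRenewal hs n (s + 1) f

/-- Leaf test of the search on the array of heights `X_0, …, X_n` (all `X_i > 0` for `i ≥ 1` already ensured by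
pruning): `n ≥ 1`, bridge (`X_i ≤ X_n`), and no renewal time in `[1, n-1]`. Untrusted.
[cite: Jensen2004SAWLowerBounds, §2] -/
def leafOK (hs : Array ℤ) : Bool :=
  let n := hs.size - 1
  decide (1 ≤ n) && allLe hs (hs.getD n 0) 1 n && !anyRenewal hs n 1 (n - 1)

/-- The search: extend the reversed word `wr` (current pair `p`, visited pairs `vis`, heights so far `hs`) by
`k` more steps in all ways that stay self-avoiding and in the half-space `X > 0`; at depth `k = 0` the words passing
`leafOK` are added in front of the accumulator `acc`, so that the final list is in increasing lexicographic order.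
Untrusted (only its output is checked). [cite: Jensen2004SAWLowerBounds, §2] -/
def go :
    ℕ → List TriStep → ℤ × ℤ → List (ℤ × ℤ) → Array ℤ → List (List TriStep) → List (List TriStep)
  | 0, wr, _, _, hs, acc => if leafOK hs then wr.reverse :: acc else acc
  | k + 1, wr, p, vis, hs, acc =>
    let ext : TriStep → List (List TriStep) → List (List TriStep) := fun d acc' =>
      let q := TriFiniteMemory.pxy d p
      let h := hgt q
      if h ≤ 0 || vis.elem q then acc' else go k (d :: wr) q (q :: vis) (hs.push h) acc'
    ext 0 (ext 1 (ext 2 (ext 3 (ext 4 (ext 5 acc)))))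

/-- The (untrusted) list of step words of the `n`-step irreducible bridges of `𝕋`, lexicographically increasing.
[cite: Jensen2004SAWLowerBounds, §2] -/
def dfs (n : ℕ) : List (List TriStep) := go n [] (0, 0) [(0, 0)] #[0] []

/-! ### The verified acceptance test -/

/-- Integer encoding of a step word (base `7`, digits `d + 1`, most significant first); used only to check
that the emitted list is strictly increasing, hence duplicate-free. [cite: Jensen2004SAWLowerBounds, §2] -/
def enc (w : List TriStep) : ℕ := w.foldl (fun a d => a * 7 + (d.val + 1)) 0

/-- Strict order of encodings. [cite: Jensen2004SAWLowerBounds, §2] -/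
def EncLT (v w : List TriStep) : Prop := enc v < enc w

/-- `EncLT` is decidable. [cite: Jensen2004SAWLowerBounds, §2] -/
instance : DecidableRel EncLT := fun v w => inferInstanceAs (Decidable (enc v < enc w))

/-- `EncLT` is transitive. [cite: Jensen2004SAWLowerBounds, §2] -/
instance : Trans EncLT EncLT EncLT := ⟨fun h₁ h₂ => lt_trans h₁ h₂⟩

/-- `scanl f b l` lists the folds of the prefixes of `l`. [cite: PonitzTittmann2000, §2] -/
theorem scanl_eq_map_range {α β : Type*} (f : β → α → β) (b : β) (l : List α) :
    List.scanl f b l = (List.range (l.length + 1)).map fun i => List.foldl f b (l.take i) := by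
  induction l generalizing b with
  | nil => simp
  | cons x l ih =>
    rw [List.scanl_cons, ih, List.length_cons]
    conv_rhs => rw [List.range_succ_eq_map, List.map_cons, List.map_map]
    rfl

/-- **The fast vertex list is the true one**: a-p4's pair-model vertex list `TriFiniteMemory.pVerts w` (one
`scanl` over the word) is the list of coordinate pairs of `triVerts w`. [cite: PonitzTittmann2000, §2] -/
theorem pVerts_eq_map (w : List TriStep) :
    TriFiniteMemory.pVerts w = (triVerts w).map TriFiniteMemory.toPair := by
  rw [TriFiniteMemory.pVerts, scanl_eq_map_range, triVerts, List.map_map]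
  refine List.map_congr_left fun i _ => ?_
  have h := TriFiniteMemory.foldl_pxy_eq (w.take i) 0
  rw [zero_add] at h
  exact h

/-- Self-avoidance read on the fast vertex list is `IsTriSAW`. [cite: MadrasSlade1993, Definition 1.1.1] -/
theorem nodup_pVerts_iff (w : List TriStep) : (TriFiniteMemory.pVerts w).Nodup ↔ IsTriSAW w := by
  rw [pVerts_eq_map]
  exact List.nodup_map_iff TriFiniteMemory.toPair_injective

/-- The brick heights `X_i = 2x_i + y_i` of the vertices `triTraj w i`, `i = 0, …, |w|`, read off the fast vertex
list (computed once per word; all tests below read this list). [cite: Jensen2004SAWLowerBounds, §2] -/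
def heights (w : List TriStep) : List ℤ := (TriFiniteMemory.pVerts w).map hgt

/-- Entries of `heights`. [cite: Jensen2004SAWLowerBounds, §2] -/
theorem heights_getD (w : List TriStep) {i : ℕ} (hi : i ≤ w.length) :
    (heights w).getD i 0 = brickX (triTraj w i) := by
  rw [heights, pVerts_eq_map, List.map_map,
    List.getD_eq_getElem _ _ (by simpa using Nat.lt_succ_of_le hi)]
  simp only [List.getElem_map, getElem_triVerts, Function.comp_apply, hgt, TriFiniteMemory.toPair, brickX]

/-- The height of the brick-frame vertex function at time `i ≤ n` is the `i`-th entry of `heights`.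
[cite: MadrasSlade1993, §1.1] -/
theorem brickFun_triVerts_apply_zero (w : List TriStep) {n i : ℕ} (hn : w.length = n) (hi : i ≤ n) :
    brickFun n (triVerts w) i 0 = (heights w).getD i 0 := by
  rw [brickFun_apply, min_eq_left hi, toBrick_apply_zero_eq_brickX, getD_triVerts w (by omega),
    heights_getD w (by omega)]

/-- Bridge test for the segment `[a, a+b]` of a height list: `X_a < X_{a+i} ≤ X_{a+b}` for `1 ≤ i ≤ b`
(Madras–Slade Definition 1.2.4 for the shifted walk). [cite: MadrasSlade1993, Definition 1.2.4 (p. 10)] -/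
def segB (hs : List ℤ) (a b : ℕ) : Bool :=
  (List.range' 1 b).all fun i => decide (hs.getD a 0 < hs.getD (a + i) 0 ∧ hs.getD (a + i) 0 ≤ hs.getD (a + b) 0)

/-- `segB` on `heights w` is the tree's `Zd.IsBridge` for the shifted brick-frame vertex function.
[cite: MadrasSlade1993, Definition 1.2.4 (p. 10)] -/
theorem segB_iff {n : ℕ} {w : List TriStep} (hn : w.length = n) {a b : ℕ} (hab : a + b ≤ n) :
    segB (heights w) a b = true ↔ Zd.IsBridge b (fun j => brickFun n (triVerts w) (a + j)) := by
  have e : ∀ j, j ≤ b → brickFun n (triVerts w) (a + j) 0 = (heights w).getD (a + j) 0 :=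
    fun j hj => brickFun_triVerts_apply_zero w hn (by omega)
  simp only [segB, List.all_eq_true, List.mem_range'_1, decide_eq_true_eq, Zd.IsBridge]
  constructor
  · intro h i h1 h2
    rw [e 0 (Nat.zero_le _), e i h2, e b le_rfl, Nat.add_zero]
    exact h i ⟨h1, by omega⟩
  · intro h i hi
    have := h i hi.1 (by omega)
    rwa [e 0 (Nat.zero_le _), e i (by omega), e b le_rfl, Nat.add_zero] at this

/-- Irreducible-bridge test on a height list: a bridge on `[0, n]`, `n ≥ 1`, with no renewal time `k ∈ [1, n-1]`
(no `k` at which both `[0, k]` and `[k, n]` are bridges). [cite: MadrasSlade1993, Definition 4.2.1 (p. 89)] -/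
def irrB (n : ℕ) (hs : List ℤ) : Bool :=
  decide (1 ≤ n) && segB hs 0 n && (List.range' 1 (n - 1)).all fun k => !(segB hs 0 k && segB hs k (n - k))

/-- **Soundness of the fast test**: `irrB n (heights w)` implies that the brick-frame vertex function of `w` is an
irreducible bridge in the sense of the tree (`Zd.IsIrreducibleBridge`).
[cite: MadrasSlade1993, Definition 4.2.1 (p. 89)] -/
theorem isIrreducibleBridge_of_irrB {n : ℕ} {w : List TriStep} (hn : w.length = n)
    (h : irrB n (heights w) = true) : Zd.IsIrreducibleBridge n (brickFun n (triVerts w)) := by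
  simp only [irrB, Bool.and_eq_true, decide_eq_true_eq, List.all_eq_true, List.mem_range'_1] at h
  obtain ⟨⟨h1, hB⟩, hI⟩ := h
  refine ⟨h1, ?_, fun k hk1 hk2 hR => ?_⟩
  · have := (segB_iff hn (show 0 + n ≤ n by omega)).1 hB
    simpa only [Nat.zero_add] using this
  · obtain ⟨-, hb1, hb2⟩ := hR
    have hk := hI k ⟨hk1, by omega⟩
    have e1 : segB (heights w) 0 k = true :=
      (segB_iff hn (show 0 + k ≤ n by omega)).2 (by simpa only [Nat.zero_add] using hb1)
    have e2 : segB (heights w) k (n - k) = true := (segB_iff hn (by omega)).2 hb2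
    simp [e1, e2] at hk

/-- **The acceptance test for one word**: length `n`, self-avoiding (tested on the pair-model vertex list
`TriFiniteMemory.pVerts w = (triVerts w).map toPair`), and the height list passes `irrB n` (so that its
brick-frame vertex function is an irreducible bridge in the sense of the tree, Madras–Slade Definition 4.2.1 on
the height `X = 2x + y`). [cite: MadrasSlade1993, Definition 4.2.1 (p. 89)] -/
def WordOK (n : ℕ) (w : List TriStep) : Prop :=
  w.length = n ∧ (TriFiniteMemory.pVerts w).Nodup ∧ irrB n (heights w) = true

/-- `WordOK n w` is decidable. [cite: MadrasSlade1993, Definition 4.2.1 (p. 89)] -/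
instance (n : ℕ) (w : List TriStep) : Decidable (WordOK n w) :=
  inferInstanceAs (Decidable (w.length = n ∧ (TriFiniteMemory.pVerts w).Nodup ∧ irrB n (heights w) = true))

/-- **The certificate check**: the search emits exactly `m` words, each accepted, in strictly increasing order.
[cite: Jensen2004SAWLowerBounds, §2] -/
def cert (n m : ℕ) : Bool :=
  let L := dfs n
  decide (L.length = m) && L.all (fun w => decide (WordOK n w)) && decide (L.IsChain EncLT)

/-- The brick-frame vertex function of an accepted word is an irreducible bridge of `𝕋`.
[cite: MadrasSlade1993, Definition 4.2.1 (p. 89)] -/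
theorem mem_brickIrreducibleBridges_of_wordOK {n : ℕ} {w : List TriStep} (h : WordOK n w) :
    brickFun n (triVerts w) ∈ brickIrreducibleBridges n := by
  classical
  obtain ⟨hl, hs', hB⟩ := h
  have hs : IsTriSAW w := (nodup_pVerts_iff w).1 hs'
  have hirr := isIrreducibleBridge_of_irrB hl hB
  have hsaw : brickFun n (triVerts w) ∈ brickSaws n := by
    rw [brickSaws, Finset.mem_image]
    exact ⟨triVerts w, triVerts_mem_triSL hl hs, rfl⟩
  exact mem_brickIrreducibleBridges.2 ⟨mem_brickBridges.2 ⟨hsaw, hirr.2.1⟩, hirr⟩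

/-- `w ↦ brickFun n (triVerts w)` is injective on accepted words. [cite: MadrasSlade1993, §1.1] -/
theorem brickFun_triVerts_injOn (n : ℕ) :
    Set.InjOn (fun w : List TriStep => brickFun n (triVerts w)) {w | WordOK n w} := by
  intro w hw w' hw' h
  have hv : triVerts w = triVerts w' :=
    brickFun_injOn n (Finset.mem_coe.2 (triVerts_mem_triSL hw.1 ((nodup_pVerts_iff w).1 hw.2.1)))
      (Finset.mem_coe.2 (triVerts_mem_triSL hw'.1 ((nodup_pVerts_iff w').1 hw'.2.1))) h
  exact triVerts_injOn n (by simpa using hw.1) (by simpa using hw'.1) hv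

/-- A list strictly increasing in `enc` has no duplicates. [cite: Jensen2004SAWLowerBounds, §2] -/
theorem nodup_of_chain {L : List (List TriStep)} (h : L.IsChain EncLT) : L.Nodup :=
  h.pairwise.imp fun hab heq => by subst heq; exact lt_irrefl _ hab

/-- **Soundness of the certificate**: `cert n m = true → m ≤ λ_n(𝕋)`. [cite: Jensen2004SAWLowerBounds, §2]
[cite: MadrasSlade1993, Definition 4.2.1 (p. 89)] -/
theorem le_of_cert {n m : ℕ} (h : cert n m = true) : m ≤ brickIrreducibleBridgeCount n := by
  classical
  simp only [cert, Bool.and_eq_true, decide_eq_true_eq, List.all_eq_true] at h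
  obtain ⟨⟨hlen, hall⟩, hchain⟩ := h
  have hnd : (dfs n).Nodup := nodup_of_chain hchain
  have hOK : ∀ w ∈ (dfs n).toFinset, WordOK n w := fun w hw => hall w (List.mem_toFinset.1 hw)
  calc m = (dfs n).toFinset.card := by rw [List.toFinset_card_of_nodup hnd, hlen]
    _ = ((dfs n).toFinset.image fun w => brickFun n (triVerts w)).card := by
        rw [Finset.card_image_of_injOn fun w hw w' hw' hww' =>
          brickFun_triVerts_injOn n (hOK w hw) (hOK w' hw') hww']
    _ ≤ #(brickIrreducibleBridges n) := by
        refine Finset.card_le_card fun ω hω => ?_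
        obtain ⟨w, hw, rfl⟩ := Finset.mem_image.1 hω
        exact mem_brickIrreducibleBridges_of_wordOK (hOK w hw)
    _ = brickIrreducibleBridgeCount n := rfl

/-! ### The evaluations (computational class: one `native_decide` each) -/

/-- `λ_1(𝕋) ≥ 3` (the three steps of positive height). [cite: Jensen2004SAWLowerBounds, §2] -/
theorem three_le_lambda_one : 3 ≤ brickIrreducibleBridgeCount 1 := le_of_cert (by native_decide)

/-- `λ_3(𝕋) ≥ 4`. [cite: Jensen2004SAWLowerBounds, §2] -/
theorem four_le_lambda_three : 4 ≤ brickIrreducibleBridgeCount 3 := le_of_cert (by native_decide)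

/-- `λ_4(𝕋) ≥ 12`. [cite: Jensen2004SAWLowerBounds, §2] -/
theorem le_lambda_four : 12 ≤ brickIrreducibleBridgeCount 4 := le_of_cert (by native_decide)

/-- `λ_5(𝕋) ≥ 20`. [cite: Jensen2004SAWLowerBounds, §2] -/
theorem le_lambda_five : 20 ≤ brickIrreducibleBridgeCount 5 := le_of_cert (by native_decide)

/-- `λ_6(𝕋) ≥ 90`. [cite: Jensen2004SAWLowerBounds, §2] -/
theorem le_lambda_six : 90 ≤ brickIrreducibleBridgeCount 6 := le_of_cert (by native_decide)

/-- `λ_7(𝕋) ≥ 242`. [cite: Jensen2004SAWLowerBounds, §2] -/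
theorem le_lambda_seven : 242 ≤ brickIrreducibleBridgeCount 7 := le_of_cert (by native_decide)

/-- `λ_8(𝕋) ≥ 856`. [cite: Jensen2004SAWLowerBounds, §2] -/
theorem le_lambda_eight : 856 ≤ brickIrreducibleBridgeCount 8 := le_of_cert (by native_decide)

/-- `λ_9(𝕋) ≥ 2890`. [cite: Jensen2004SAWLowerBounds, §2] -/
theorem le_lambda_nine : 2890 ≤ brickIrreducibleBridgeCount 9 := le_of_cert (by native_decide)

/-- `λ_10(𝕋) ≥ 10088`. [cite: Jensen2004SAWLowerBounds, §2] -/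
theorem le_lambda_ten : 10088 ≤ brickIrreducibleBridgeCount 10 := le_of_cert (by native_decide)

/-- `λ_11(𝕋) ≥ 35988`. [cite: Jensen2004SAWLowerBounds, §2] -/
theorem le_lambda_eleven : 35988 ≤ brickIrreducibleBridgeCount 11 := le_of_cert (by native_decide)

end TriIrrCert

/-! ### The numeral -/

open TriIrrCert in
/-- **`μ(𝕋) > 3.91`**: `391/100 < exp logMuTri`, from `Σ_{n ≤ 11} λ_n(𝕋) (100/391)^n > 1` (the certified counts
give `≥ 1.0022`) and Kesten's inequality `Σ_n λ_n(𝕋) μ(𝕋)^{-n} ≤ 1` (`inv_lt_exp_logMuTri_of_one_lt_sum`).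
Printed bounds by the same method reach `4.118935` (Jensen 2004, §2); this one is weaker but kernel-checked.
[cite: Jensen2004SAWLowerBounds, §2 (Kesten's method; `4.118935 < μ_tri`, previous `4.03333`)]
[cite: Alm2005, §5.5.1] [cite: Kesten1963SAW, §4] [cite: MadrasSlade1993, §4.2, eq. (4.2.3)–(4.2.4) (pp. 90–91)] -/
theorem exp_logMuTri_gt_391_div_100 : (391 : ℝ) / 100 < Real.exp logMuTri := by
  have hx : (0 : ℝ) < 100 / 391 := by norm_num
  have key : (1 : ℝ) < ∑ k ∈ Finset.range 12, (brickIrreducibleBridgeCount k : ℝ) * (100 / 391) ^ k := by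
    have h1 : (3 : ℝ) ≤ brickIrreducibleBridgeCount 1 := by exact_mod_cast three_le_lambda_one
    have h2 : (0 : ℝ) ≤ brickIrreducibleBridgeCount 2 := Nat.cast_nonneg _
    have h3 : (4 : ℝ) ≤ brickIrreducibleBridgeCount 3 := by exact_mod_cast four_le_lambda_three
    have h4 : (12 : ℝ) ≤ brickIrreducibleBridgeCount 4 := by exact_mod_cast le_lambda_four
    have h5 : (20 : ℝ) ≤ brickIrreducibleBridgeCount 5 := by exact_mod_cast le_lambda_five
    have h6 : (90 : ℝ) ≤ brickIrreducibleBridgeCount 6 := by exact_mod_cast le_lambda_six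
    have h7 : (242 : ℝ) ≤ brickIrreducibleBridgeCount 7 := by exact_mod_cast le_lambda_seven
    have h8 : (856 : ℝ) ≤ brickIrreducibleBridgeCount 8 := by exact_mod_cast le_lambda_eight
    have h9 : (2890 : ℝ) ≤ brickIrreducibleBridgeCount 9 := by exact_mod_cast le_lambda_nine
    have h10 : (10088 : ℝ) ≤ brickIrreducibleBridgeCount 10 := by exact_mod_cast le_lambda_ten
    have h11 : (35988 : ℝ) ≤ brickIrreducibleBridgeCount 11 := by exact_mod_cast le_lambda_eleven
    simp only [Finset.sum_range_succ, Finset.sum_range_zero, brickIrreducibleBridgeCount_zero, Nat.cast_zero,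
      zero_mul, zero_add, pow_one]
    norm_num
    linarith [h1, h2, h3, h4, h5, h6, h7, h8, h9, h10, h11]
  have := inv_lt_exp_logMuTri_of_one_lt_sum _ hx key
  rwa [inv_div] at this

/-- `log 3.91 < log μ(𝕋)`. [cite: Jensen2004SAWLowerBounds, §2] -/
theorem log_391_div_100_lt_logMuTri : Real.log ((391 : ℝ) / 100) < logMuTri := by
  have h := Real.log_lt_log (by norm_num) exp_logMuTri_gt_391_div_100
  rwa [Real.log_exp] at h

end Literature.Probability.RandomPlanarGeometry.SAW
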